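import Summits.ResolutionOfSingularities.ResolutionOfSingularities.Theorems.PurelyInseparableDim4PhiLineStepLaws
import HarnessLib

/-!
# (K-Φ2) chain dictionary XII: THE LOSE-h LAW CUT FROM THE CHILD SIDE — `hδ2` replaced by the child's isolation data

Cell `res-dim4-pi` (D-0157 DOOR 2), Φ = β_h line (CARD I-1-8; B∞ assembly skeleton of res-dim4-p-12, STUB L). (K-Φ2) IV `betaS_step_le_of_lose`
uses `hδ2 : δs < 2·d!` only to make the weak transform's `αs = δs − d!` smaller than `d!`, so that (K-Φ3) V (cleaning-blindness) absorbs the cleaning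
term `R ∈ (x_h^d)` and the unit `ε` of the actual child residual `G′ = ε·H₀ + R`. Cleaning-blindness is symmetric (`H₀ = ε⁻¹·G′ + (−ε⁻¹ R)`), so it
can be run from the child, whose `pts ≠ ∅ ∧ αs′ < d!` the chain knows from isolation ((K-Φ1)). This file proves (DEF-FREE):

* `pts_nonempty_and_alphaS_betaS_eq_of_cleaning_symm` — (K-Φ3) V read from the result side;
* **`betaS_step_le_of_lose_of_child`** — IV-lose with `hδ2` replaced by `(hne′, hα′)`: `αs′ + d! = δs ∧ βs′ ≤ βs`;
* `deltaS_lt_two_mul_factorial_of_child` — corollary `δs < 2·d!` (contrapositive: `δs ≥ 2·d!` ⇒ the child is not isolated).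

[OURS · counted 0 · AI work weaker than expert review.] Nothing here proves K2(p), the β_h line, or resolution of singularities in dimension ≥ 4 /
characteristic p.

Sources: V. Cossart, U. Jannsen, S. Saito (2020) Lemma 12.1 (3), Lemma 11.5 [`CossartJannsenSaito2020`]; V. Cossart, O. Piltant, J. Algebra 320
(2008) Lemma 4.5 (2) [`CossartPiltant2008`].
-/

set_option linter.dupNamespace false

noncomputable section

universe u

namespace Summit.ResolutionOfSingularities.ResolutionOfSingularities.Theorems.PIDim4

namespace PhiLine

open MvPolynomial Finset IsLocalRing
open Literature.AlgebraicGeometry.Resolution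
open Literature.AlgebraicGeometry.Resolution.Hauser2010
open Literature.AlgebraicGeometry.Resolution.WeightedOrder

section Symm

variable {R : Type u} [CommRing R] [IsRegularLocalRing R] {r : ℕ} (c : Fin (r + 2) → R)
  (hgen : Ideal.span (Set.range c) = maximalIdeal R) (hdim : ringKrullDim R = r + 2) {μ : ℕ}

include hgen hdim in
/-- **Cleaning-blindness from the result side**: if `ε` is a unit, `(g) ⊆ 𝔪^μ`, `ρ ∈ (u₁^μ)`, and the PERTURBED generator `ε g + ρ` has non-empty
polygon with `αs < μ!`, then `(g)` has non-empty polygon and the same `αs`, `βs` — (K-Φ3) V applied to `g = ε⁻¹(ε g + ρ) + (−ε⁻¹ρ)`.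
[cite: CossartJannsenSaito2020, Lemma 12.2 (1)] [cite: CossartPiltant2008, Lemma 4.5 (2)] -/
theorem pts_nonempty_and_alphaS_betaS_eq_of_cleaning_symm {g ρ ε : R} (hε : IsUnit ε) (hJμ : Ideal.span {g} ≤ maximalIdeal R ^ μ)
    (hne : (pts c (Ideal.span {ε * g + ρ}) μ).Nonempty) (hα : alphaS c (Ideal.span {ε * g + ρ}) μ < μ.factorial)
    (hρ : ρ ∈ Ideal.span {c (u1 r) ^ μ}) :
    (pts c (Ideal.span {g}) μ).Nonempty ∧ alphaS c (Ideal.span {ε * g + ρ}) μ = alphaS c (Ideal.span {g}) μ ∧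
      betaS c (Ideal.span {ε * g + ρ}) μ = betaS c (Ideal.span {g}) μ := by
  obtain ⟨u, rfl⟩ := hε
  have hu1 : c (u1 r) ∈ maximalIdeal R := by rw [← hgen]; exact Ideal.subset_span ⟨u1 r, rfl⟩
  have hρμ : ρ ∈ maximalIdeal R ^ μ :=
    (Ideal.span_le.mpr (Set.singleton_subset_iff.mpr (Ideal.pow_mem_pow hu1 μ))) hρ
  have hJμ' : Ideal.span {↑u * g + ρ} ≤ maximalIdeal R ^ μ := by
    rw [Ideal.span_singleton_le_iff_mem]
    exact Ideal.add_mem _ (Ideal.mul_mem_left _ _ (hJμ (Ideal.mem_span_singleton_self g))) hρμ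
  have hρ' : -(↑u⁻¹ * ρ) ∈ Ideal.span {c (u1 r) ^ μ} := (Ideal.neg_mem_iff _).mpr (Ideal.mul_mem_left _ _ hρ)
  have h := pts_nonempty_and_alphaS_betaS_eq_of_cleaning c hgen hdim (Units.isUnit u⁻¹) hJμ' hne hα hρ'
  have hg : ↑u⁻¹ * (↑u * g + ρ) + -(↑u⁻¹ * ρ) = g := by
    rw [mul_add, ← mul_assoc, Units.inv_mul, one_mul, add_neg_cancel_right]
  rw [hg] at h
  exact ⟨h.1, h.2.1.symm, h.2.2.symm⟩

end Symm

variable {K : Type} [Field K]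

/-- **LOSE-h law with the `δ < 2` input REPLACED by the child's (K-Φ1) data** (ruling (a′) on the B∞ skeleton's design point): same as
(K-Φ2) IV `betaS_step_le_of_lose`, but instead of `hδ2 : δs < 2·d!` it takes `pts c′ (G′/1) d ≠ ∅` and `αs′ < d!` about the CHILD residual in the
arrival frame (delivered on the chain by (K-Φ1) `alphaS_lt_of_isIsolated` at the child, isolated with `r′_h + d = p`), and runs cleaning-blindness
from the child side (`H₀ = ε⁻¹·G′ − ε⁻¹·R`). Conclusion: `αs′ + d! = δs` and `βs′ ≤ βs`; `δs < 2·d!` is then a corollary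
(`deltaS_lt_two_mul_factorial_of_child`). [cite: CossartJannsenSaito2020, Lemma 12.1 (3)] [cite: CossartPiltant2008, Lemma 4.5 (2)] -/
theorem betaS_step_le_of_lose_of_child {p d : ℕ} [DecidableEq K] {s : State K} {r : Fin 4 →₀ ℕ} {G : MvPolynomial (Fin 4) K}
    (hF : s.F = monomial r 1 * G) (hd : ordZero G = d) (hp : p ≤ r.degree + d)
    {h : Fin 4} {b : Fin 4 → K} (hbh : b h = 0)
    (hndvd : ¬ p ∣ (r.degree + d - p)) (hcrit' : r.degree + d - p + d ≤ p)
    (L L' : Fin (2 + 2) → Fin 4 → K) (M M' : Fin 4 → Fin (2 + 2) → K)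
    (hM : ∀ t u, ∑ i, M t i * L i u = if t = u then 1 else 0) (hM' : ∀ t u, ∑ i, M' t i * L' i u = if t = u then 1 else 0)
    (hLu1 : L (u1 2) = Pi.single h 1)
    (hnear : ∀ i, i ≠ u1 2 → ∑ t, L i t * Function.update b h 1 t = 0)
    (hL'u1 : L' (u1 2) = Pi.single h 1) (hL' : ∀ i, i ≠ u1 2 → L' i = Function.update (L i) h 0)
    (hne : (pts (fun i => algebraMap (MvPolynomial (Fin 4) K) (OriginLocalization K 4) (∑ t, C (L i t) * X t))
      (Ideal.span {algebraMap (MvPolynomial (Fin 4) K) (OriginLocalization K 4) G}) d).Nonempty)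
    (hδ : d.factorial < deltaS (fun i => algebraMap (MvPolynomial (Fin 4) K) (OriginLocalization K 4) (∑ t, C (L i t) * X t))
      (Ideal.span {algebraMap (MvPolynomial (Fin 4) K) (OriginLocalization K 4) G}) d)
    {G' : MvPolynomial (Fin 4) K}
    (hF' : (CentreBlowup.step p Finset.univ h b s).F = monomial ((r.filter fun i => b i = 0).update h (r.degree + d - p)) 1 * G')
    (hd' : (d : ℕ∞) ≤ ordZero G')
    (hne' : (pts (fun i => algebraMap (MvPolynomial (Fin 4) K) (OriginLocalization K 4) (∑ t, C (L' i t) * X t))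
      (Ideal.span {algebraMap (MvPolynomial (Fin 4) K) (OriginLocalization K 4) G'}) d).Nonempty)
    (hα' : alphaS (fun i => algebraMap (MvPolynomial (Fin 4) K) (OriginLocalization K 4) (∑ t, C (L' i t) * X t))
      (Ideal.span {algebraMap (MvPolynomial (Fin 4) K) (OriginLocalization K 4) G'}) d < d.factorial) :
    alphaS (fun i => algebraMap (MvPolynomial (Fin 4) K) (OriginLocalization K 4) (∑ t, C (L' i t) * X t))
          (Ideal.span {algebraMap (MvPolynomial (Fin 4) K) (OriginLocalization K 4) G'}) d + d.factorial =
        deltaS (fun i => algebraMap (MvPolynomial (Fin 4) K) (OriginLocalization K 4) (∑ t, C (L i t) * X t))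
          (Ideal.span {algebraMap (MvPolynomial (Fin 4) K) (OriginLocalization K 4) G}) d ∧
      betaS (fun i => algebraMap (MvPolynomial (Fin 4) K) (OriginLocalization K 4) (∑ t, C (L' i t) * X t))
          (Ideal.span {algebraMap (MvPolynomial (Fin 4) K) (OriginLocalization K 4) G'}) d ≤
        betaS (fun i => algebraMap (MvPolynomial (Fin 4) K) (OriginLocalization K 4) (∑ t, C (L i t) * X t))
          (Ideal.span {algebraMap (MvPolynomial (Fin 4) K) (OriginLocalization K 4) G}) d := by
  set alg := algebraMap (MvPolynomial (Fin 4) K) (OriginLocalization K 4) with halg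
  set c : Fin (2 + 2) → OriginLocalization K 4 := fun i => alg (∑ t, C (L i t) * X t) with hc
  set c' : Fin (2 + 2) → OriginLocalization K 4 := fun i => alg (∑ t, C (L' i t) * X t) with hc'
  set J : Ideal (OriginLocalization K 4) := Ideal.span {alg G} with hJ
  set φ := Localization.localRingHom (Literature.AlgebraicGeometry.Resolution.originIdeal K 4)
      (Literature.AlgebraicGeometry.Resolution.originIdeal K 4)
      (((aeval fun i => (X i + C (b i) : MvPolynomial (Fin 4) K)).comp
        (coordBlowupSubst K (↑(Finset.univ : Finset (Fin 4))) h)).toRingHom)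
      (comap_translate_coordBlowupSubst_originIdeal hbh) with hφ
  have hdG : (d : ℕ∞) ≤ ordZero G := hd.symm.le
  have hcu1 : c (u1 2) = alg (X h) := by simp only [hc, hLu1, sum_C_single_mul_X]
  have hc'u1 : c' (u1 2) = alg (X h) := by simp only [hc', hL'u1, sum_C_single_mul_X]
  have hpiv : c' (u1 2) = φ (c (u1 2)) := by rw [hc'u1, hcu1, hφ, localRingHom_chart_X_self hbh]
  have hoth : ∀ i, i ≠ u1 2 → φ (c i) = φ (c (u1 2)) * c' i := by
    intro i hi
    rw [hcu1, hφ, localRingHom_chart_X_self hbh]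
    change Localization.localRingHom _ _ _ _ (alg (∑ t, C (L i t) * X t)) = alg (X h) * alg (∑ t, C (L' i t) * X t)
    rw [hL' i hi, halg, localRingHom_chart_linearForm hbh (L i) (hnear i hi)]
  have hgen : Ideal.span (Set.range c) = maximalIdeal _ := span_range_linearFrame_eq_maximalIdeal L M hM
  have hgen' : Ideal.span (Set.range c') = maximalIdeal _ := span_range_linearFrame_eq_maximalIdeal L' M' hM'
  have hdim := ringKrullDim_originLocalization_two_add_two (K := K)
  have hJμ : J ≤ maximalIdeal _ ^ d := span_singleton_algebraMap_le_maximalIdeal_pow hdG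
  -- the abstract LOSE law (`u₁`-chart)
  have hαlaw := alphaS_colon_add φ hpiv hoth hgen hdim hgen' hdim hJμ hne hδ
  have hβlaw := betaS_colon_le φ hpiv hoth hgen hdim hgen' hdim hJμ hne hδ
  have hcolon : (J.map φ).colon {φ (c (u1 2)) ^ d} =
      Ideal.span {alg (PointBlowup.translate b (CentreBlowup.chartTransform d Finset.univ h G))} := by
    rw [hcu1, hφ, localRingHom_chart_X_self hbh, hJ, halg]
    exact colon_map_span_singleton_chart hbh G hdG
  rw [hcolon] at hαlaw hβlaw
  -- the next residual
  obtain ⟨R, hstep, hRmem⟩ := step_F_eq_monomial_mul_residual (p := p) hF hdG hp h hbh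
  rw [hF', monomial_one_mul_cancel_left_iff] at hstep
  have hr'h : ((r.filter fun i => b i = 0).update h (r.degree + d - p)) h = r.degree + d - p := by
    rw [Finsupp.coe_update, Function.update_self]
  have hR : R ∈ Ideal.span {(X h : MvPolynomial (Fin 4) K) ^ (p - (r.degree + d - p))} := by
    have := hRmem h (by rw [hr'h]; exact hndvd)
    rwa [hr'h] at this
  have hRd : R ∈ Ideal.span {(X h : MvPolynomial (Fin 4) K) ^ d} := by
    obtain ⟨q, rfl⟩ := Ideal.mem_span_singleton'.mp hR
    obtain ⟨k, hk⟩ := Nat.exists_eq_add_of_le (show d ≤ p - (r.degree + d - p) by omega)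
    rw [hk, Ideal.mem_span_singleton]
    exact Dvd.dvd.mul_left (pow_dvd_pow (X h) (Nat.le_add_right d k)) _
  have hε := constantCoeff_prod_ne_zero b (fun i => r i)
  have hH₀ : (d : ℕ∞) ≤ ordZero (PointBlowup.translate b (CentreBlowup.chartTransform d Finset.univ h G)) :=
    le_ordZero_of_eq_unit_mul_add hstep hd' hε hRd
  have hG' : Ideal.span {alg G'} = Ideal.span {alg (∏ i ∈ Finset.univ.filter (fun i => b i ≠ 0), (X i + C (b i)) ^ r i) *
      alg (PointBlowup.translate b (CentreBlowup.chartTransform d Finset.univ h G)) + alg R} := by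
    rw [hstep, map_add, map_mul]
  -- cleaning-blindness run FROM THE CHILD: `H₀ = ε⁻¹ G′ − ε⁻¹ R`
  have hne'' : (pts c' (Ideal.span {alg G'}) d).Nonempty := hne'
  have hα'' : alphaS c' (Ideal.span {alg G'}) d < d.factorial := hα'
  rw [hG'] at hne'' hα''
  have hclean := pts_nonempty_and_alphaS_betaS_eq_of_cleaning_symm c' hgen' hdim (isUnit_algebraMap_of_constantCoeff_ne_zero hε)
    (span_singleton_algebraMap_le_maximalIdeal_pow hH₀) hne'' hα''
    (by rw [hc'u1]; exact algebraMap_mem_span_pow_of_mem_span_pow le_rfl hRd)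
  change alphaS c' (Ideal.span {alg G'}) d + d.factorial = deltaS c J d ∧ betaS c' (Ideal.span {alg G'}) d ≤ betaS c J d
  rw [hG', hclean.2.1, hclean.2.2]
  exact ⟨hαlaw, hβlaw⟩

/-- **Corollary: `δs < 2·d!` at a LOSE-h parent whose child is isolated** (with the child's (K-Φ1) data as input) — the contrapositive of the
skeleton's option (b) «`δs ≥ 2·d!` ⇒ the child is not isolated». [cite: CossartJannsenSaito2020, Lemma 12.1 (3)] -/
theorem deltaS_lt_two_mul_factorial_of_child {p d : ℕ} [DecidableEq K] {s : State K} {r : Fin 4 →₀ ℕ} {G : MvPolynomial (Fin 4) K}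
    (hF : s.F = monomial r 1 * G) (hd : ordZero G = d) (hp : p ≤ r.degree + d)
    {h : Fin 4} {b : Fin 4 → K} (hbh : b h = 0)
    (hndvd : ¬ p ∣ (r.degree + d - p)) (hcrit' : r.degree + d - p + d ≤ p)
    (L L' : Fin (2 + 2) → Fin 4 → K) (M M' : Fin 4 → Fin (2 + 2) → K)
    (hM : ∀ t u, ∑ i, M t i * L i u = if t = u then 1 else 0) (hM' : ∀ t u, ∑ i, M' t i * L' i u = if t = u then 1 else 0)
    (hLu1 : L (u1 2) = Pi.single h 1)
    (hnear : ∀ i, i ≠ u1 2 → ∑ t, L i t * Function.update b h 1 t = 0)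
    (hL'u1 : L' (u1 2) = Pi.single h 1) (hL' : ∀ i, i ≠ u1 2 → L' i = Function.update (L i) h 0)
    (hne : (pts (fun i => algebraMap (MvPolynomial (Fin 4) K) (OriginLocalization K 4) (∑ t, C (L i t) * X t))
      (Ideal.span {algebraMap (MvPolynomial (Fin 4) K) (OriginLocalization K 4) G}) d).Nonempty)
    (hδ : d.factorial < deltaS (fun i => algebraMap (MvPolynomial (Fin 4) K) (OriginLocalization K 4) (∑ t, C (L i t) * X t))
      (Ideal.span {algebraMap (MvPolynomial (Fin 4) K) (OriginLocalization K 4) G}) d)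
    {G' : MvPolynomial (Fin 4) K}
    (hF' : (CentreBlowup.step p Finset.univ h b s).F = monomial ((r.filter fun i => b i = 0).update h (r.degree + d - p)) 1 * G')
    (hd' : (d : ℕ∞) ≤ ordZero G')
    (hne' : (pts (fun i => algebraMap (MvPolynomial (Fin 4) K) (OriginLocalization K 4) (∑ t, C (L' i t) * X t))
      (Ideal.span {algebraMap (MvPolynomial (Fin 4) K) (OriginLocalization K 4) G'}) d).Nonempty)
    (hα' : alphaS (fun i => algebraMap (MvPolynomial (Fin 4) K) (OriginLocalization K 4) (∑ t, C (L' i t) * X t))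
      (Ideal.span {algebraMap (MvPolynomial (Fin 4) K) (OriginLocalization K 4) G'}) d < d.factorial) :
    deltaS (fun i => algebraMap (MvPolynomial (Fin 4) K) (OriginLocalization K 4) (∑ t, C (L i t) * X t))
      (Ideal.span {algebraMap (MvPolynomial (Fin 4) K) (OriginLocalization K 4) G}) d < 2 * d.factorial := by
  have h := (betaS_step_le_of_lose_of_child hF hd hp hbh hndvd hcrit' L L' M M' hM hM' hLu1 hnear hL'u1 hL' hne hδ hF' hd' hne' hα').1
  omega

end PhiLine

end Summit.ResolutionOfSingularities.ResolutionOfSingularities.Theorems.PIDim4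

end
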